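/-
Copyright (c) 2026. All rights reserved.
Released under Apache 2.0 license as described in the file LICENSE.
Authors: abc-iut cell, seat abc-iut-f-081 (F fact-proving wave, tranche 81: F-0360, F-0361, F-0362).
-/
import Literature.AnabelianGeometry.AbsoluteAnabelian.AbsTopIII.LogFrobeniusToyWitness
import Literature.AnabelianGeometry.AbsoluteAnabelian.AbsTopIII.AutHolLogFrobeniusModelProofs
import Literature.AnabelianGeometry.AbsoluteAnabelian.AbsTopIII.FrobeniusPictureMLFModel
import Mathlib.CategoryTheory.SingleObj
import Mathlib.CategoryTheory.PUnit
import Mathlib.Algebra.Group.Nat.TypeTags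
import HarnessLib

/-!
# [AbsTopIII] Cor. 3.6 (iii)/(iv) as typed: the three SCHEMA rows of `FrobeniusPictureMLFTelecore.lean`
# — universal closures REFUTED, instance forms PROVED / located

S. Mochizuki, *Topics in Absolute Anabelian Geometry III* [MochizukiAbsTopIII2015] (kurims manuscript
`paper:url-5493eb38cbb7`, cell render `HOME/lit/renders/AbsTopIII-kurims-url-5493eb38cbb7/`):
Cor. 3.6 (iii) p. 80 with proof p. 81 l. 21–26, Cor. 3.6 (iv) p. 80 l. 19–21 with proof p. 82,
Cor. 4.5 (iii) pp. 108–109 with proof p. 110 l. 16–21, Cor. 4.5 (iv) p. 109.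

PROOF-ONLY companion (no notion is declared) of `FrobeniusPictureMLFTelecore.lean` (seat abc-iut-L4-t5),
written for the cell's FROZEN FACT-LIST rows

* F-0360 `LogFrobeniusData.IotaOverGaloisStmt Δ` (Cor. 3.6 (iii), second clause, typed by content:
  `ι_×`, `ι_{log,⋎}` lie over the identity of `ℰ`),
* F-0361 `LogFrobeniusData.TeleLogPinned Δ K` (the `𝔖_log`-pinning PREDICATE on a family `K` of the
  telecore diagram; it occurs only NEGATIVELY, inside `TelecoreIncompatibleStmt`),
* F-0362 `LogFrobeniusData.TelecoreIncompatibleStmt Δ τ` (Cor. 3.6 (iv), second sentence: `𝔗_An`, `ℋ_An`,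
  `𝔖_log` not simultaneously compatible),

all three of which are SCHEMATA over the ABSTRACT input datum `Δ : LogFrobeniusData` (arbitrary
categories and functors in the shape of Def. 3.1).  Kernel facts recorded here:

1. `not_forall_iotaOverGaloisStmt` — the universal closure of F-0360 is FALSE: at the datum all of whose
   categories are the one-object category of the commutative monoid `(ℕ, +)`, all functors identities,
   and `ι_× := 1 ≠ 0`, the Galois component of `ι_×` is not the identity.  Instance forms (both already
   in the tree): the MLF-Galois model of Cor. 3.6 (`TFModel.iotaOverGaloisStmt_model`,
   `FrobeniusPictureMLFModelProofs.lean`, abc-iut-L4-t5) and the archimedean model of Cor. 4.5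
   (`AbsTopIII.arch_iotaOverGaloisStmt`, `AutHolLogFrobeniusModelIotaProofs.lean`, abc-iut-L4-t10) —
   "because the various Galois groups [structure-orbispaces] that appear remain 'undisturbed'"
   (p. 81 / p. 110) holds there BY CONSTRUCTION.
2. `exists_not_teleLogPinned_of_telecoreStmt` — Cor. 3.6 (iv) read positively: wherever the typed
   (ii) and (iv) hold, the common family `K ⊇ 𝒥_{𝔗_An} ∪ ℋ_An` given by the contact structure is NOT
   `𝔖_log`-pinned; hence `not_forall_teleLogPinned` (the universal closure of the predicate F-0361 is
   false — instantiated at abc-iut-w5-d210's consistency witness `cor_3_6_hypotheses_satisfiable`), and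
   the NAMED model families at which the predicate fails: `AbsTopIII.TFModel.exists_not_teleLogPinned_model`
   (MLF-Galois model, from abc-iut-L4-t5's `telecoreStmt_model` / `telecoreIncompatibleStmt_model`) and
   `AbsTopIII.arch_exists_not_teleLogPinned` (archimedean model, from abc-iut-L4-t10's `cor_4_5_arch`).
3. `exists_telecoreStmt_not_telecoreIncompatibleStmt` / `not_forall_telecoreIncompatibleStmt` — the
   universal closure of F-0362 is FALSE: at the datum all of whose categories are the one-object
   DISCRETE category (so that there is no Lemma-3.4 obstruction: `λ^×(a) ≫ ι_log = ι_×`), the telecore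
   `𝔗_An` of (ii) exists (`telecoreStmt_of_coherent`) and the family of ALL co-verticial pairs of paths
   of its diagram, with the unique natural transformations as homotopies, contains `𝒥`, `ℋ_An` and is
   `𝔖_log`-pinned.  So the hypothesis `Lemma34Property` of abc-iut-L4-t5's
   `telecoreIncompatibleStmt_of_lemma34` (resp. `Lemma44Property` in abc-iut-L4-t10's
   `telecoreIncompatibleStmt_of_lemma44`) carries the content of (iv); instance forms already in the
   tree: `TFModel.telecoreIncompatibleStmt_model` (MLF model, Lemma 3.4 discharged) and the (iv)-field of
   `AbsTopIII.cor_4_5_arch` (archimedean model, Lemma 4.4 discharged).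

FACT-LIST reading (plan R5): F-0360 and F-0362 are facts AT THE NAMED MODEL INSTANCES only (universal
closure refuted, model instances proved); F-0361 is vocabulary (a predicate), not an assumption.
HONEST FRAMING: refereed pre-IUT material and toy data; calibration of typed statements; nothing here
bears on [IUTchIII] Cor. 3.12 or takes a side; typed ≠ proved for any instance not named above.
-/

namespace Literature.AnabelianGeometry.AbsoluteAnabelian

open _root_.CategoryTheory _root_.Quiver

universe u

/-! ### `eqToHom` bookkeeping -/

/-- A morphism equal to an `eqToHom` over a loop `a = a` is the identity. [folklore] -/
private theorem eq_id_of_eq_eqToHom {C : Type*} [Category C] {a : C} (p : a = a) {f : a ⟶ a}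
    (h : f = eqToHom p) : f = 𝟙 a := by
  rw [h, eqToHom_refl]

namespace LogFrobeniusData

open DiagramOfCategories

/-! ### F-0360: the universal closure of `IotaOverGaloisStmt` is false -/

/-- **F-0360 is a schema, not a fact: its universal closure is FALSE.**  There is an abstract
log-Frobenius input datum at which the typed content of Cor. 3.6 (iii)'s second clause
(`IotaOverGaloisStmt`: "`ι_×`, `ι_{log,⋎}` lie over the identity of `ℰ`") fails: all six categories the
one-object category of the commutative monoid `(ℕ, +)`, all functors identities, `ι_× := 1` (central,
hence natural) — whose image under `𝒩 → ℰ = 𝟭` is `1 ≠ 0 = 𝟙`.  (At the MLF-Galois model the clause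
HOLDS: `TFModel.iotaOverGaloisStmt_model`; at the archimedean model: `AbsTopIII.arch_iotaOverGaloisStmt`.)
[cite: MochizukiAbsTopIII2015, Corollary 3.6 (iii) pp.80–81] -/
theorem not_forall_iotaOverGaloisStmt :
    ¬ ∀ Δ : LogFrobeniusData.{0}, Δ.IotaOverGaloisStmt := by
  intro h
  let M : Type := Multiplicative ℕ
  let S : Type := CategoryTheory.SingleObj M
  -- the central, non-identity natural endotransformation `1` of the identity functor
  let ν : 𝟭 S ⟶ 𝟭 S :=
    { app := fun _ => (Multiplicative.ofAdd (1 : ℕ) : M)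
      naturality := fun _ _ f => by
        simp only [Functor.id_obj, Functor.id_map]
        exact mul_comm (Multiplicative.ofAdd (1 : ℕ) : M) (f : M) }
  let Δ : LogFrobeniusData.{0} :=
    { X₁ := S, X := S, toNexus := 𝟭 _, N := S, E := S, A := S,
      log := 𝟭 _, logIsoId := Iso.refl _, lamTimes := 𝟭 _, lamPf := 𝟭 _,
      ιlog := (Functor.rightUnitor (𝟭 S ⋙ 𝟭 S)).hom, ιtimes := Sum.inl ν,
      XtoE := 𝟭 _, NtoE := 𝟭 _, lamTimes_NtoE := Functor.comp_id _, lamPf_NtoE := Functor.comp_id _,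
      κ := 𝟭 _, AtoE := 𝟭 _, κ_equiv := inferInstance, κ_inv := Functor.rightUnitor _,
      φ := 𝟭 _, φ_equiv := inferInstance, η := Functor.rightUnitor _ ≪≫ Functor.rightUnitor _ }
  obtain ⟨h₁, -⟩ := h Δ
  have h₂ := eq_id_of_eq_eqToHom _ (h₁ (CategoryTheory.SingleObj.star M))
  -- `h₂ : ofAdd 1 = 𝟙 = 1` in `Multiplicative ℕ`
  have h₃ : (Multiplicative.ofAdd (1 : ℕ) : M) = 1 := h₂
  have h₄ := congrArg Multiplicative.toAdd h₃
  simp at h₄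

/-! ### F-0361: `TeleLogPinned` is a predicate; Cor. 3.6 (iv) read positively -/

variable (Δ : LogFrobeniusData.{u}) (τ : Δ.TelecoreData)

/-- **Cor. 3.6 (iv), second sentence, read positively.**  If the typed (ii) (`TelecoreStmt τ`: a telecore
`𝔗_An` of the printed shape over a core `(𝒟_{≤5}, Anab)` with a contact structure `ℋ_An` generated by
the printed pairs) and the typed (iv) (`TelecoreIncompatibleStmt τ`) hold, then there are such a
telecore `T` and a family `K` on its diagram containing the telecore family `𝒥` and the contact
generators — namely a common family of the compatible pair `(ℋ_An, 𝒥)` — which is NOT `𝔖_log`-pinned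
(`¬ TeleLogPinned K`): "`𝔗_An`, `ℋ_An`, `𝔖_log` are not simultaneously compatible".  In particular the
FACT-LIST row F-0361 (`TeleLogPinned`) is a PREDICATE that FAILS at named families; it is not a fact.
[cite: MochizukiAbsTopIII2015, Corollary 3.6 (iv) pp.80–82] -/
theorem exists_not_teleLogPinned_of_telecoreStmt (h₂ : Δ.TelecoreStmt τ)
    (h₄ : Δ.TelecoreIncompatibleStmt τ) :
    ∃ (H : Δ.core5Diagram.HomotopyFamily)
      (hH : ∀ ⦃a b : coreShape5.{u}.Vertex⦄ ⦃p q : Path a b⦄, H.E p q → b = coreShape5.{u}.obs)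
      (hc : (Δ.coreObs5 H hH).IsCore) (T : (Δ.sub 4).Telecore (Δ.coreObs5 H hH) hc)
      (K : (Δ.teleDiagram T.J T.telMap).HomotopyFamily),
      Δ.IsTelecoreAn τ T ∧
      (∀ ⦃a b : (teleShape T.J).Vertex⦄ (p q : Path a b), T.Jfam.E p q → K.E p q) ∧
      (∀ ⦃a b : (teleShape T.J).Vertex⦄ (p q : Path a b), ContactGen p q → K.E p q) ∧
      ¬ Δ.TeleLogPinned K := by
  obtain ⟨H, hH, hc, T, hT, Hc, hcs, hgen, -⟩ := h₂
  obtain ⟨K, hK⟩ := hcs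
  obtain ⟨hsubC, -⟩ := hK true
  obtain ⟨hsubJ, -⟩ := hK false
  have hJ : ∀ ⦃a b : (teleShape T.J).Vertex⦄ (p q : Path a b), T.Jfam.E p q → K.E p q :=
    fun a b p q h => hsubJ h
  have hC : ∀ ⦃a b : (teleShape T.J).Vertex⦄ (p q : Path a b), ContactGen p q → K.E p q :=
    fun a b p q h => hsubC ((hgen p q).2 (Saturation.base h))
  exact ⟨H, hH, hc, T, K, hT, hJ, hC, fun hpin => h₄ H hH hc T hT ⟨K, hJ, hC, hpin⟩⟩

/-- **F-0361 is a predicate, not a fact: its universal closure is FALSE** — there are a datum `Δ`, a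
telecore diagram over it and a family `K` of homotopies on that diagram with `¬ TeleLogPinned K`
(at abc-iut-w5-d210's consistency witness for Cor. 3.6, where (ii) and (iv) hold, take the common
family of `ℋ_An` and `𝒥` of `exists_not_teleLogPinned_of_telecoreStmt`).
[cite: MochizukiAbsTopIII2015, Corollary 3.6 (iv) pp.80–82] -/
theorem not_forall_teleLogPinned :
    ¬ ∀ (Δ : LogFrobeniusData.{0}) (J : SubVertex {a : LFVertex | a.row ≤ 4} → Type)
        (telMap : ∀ {a}, J a → (Δ.A ⥤ (Δ.sub 4).obj a))
        (K : (Δ.teleDiagram J telMap).HomotopyFamily), Δ.TeleLogPinned K := by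
  intro h
  obtain ⟨Δ, τ, -, -, -, -, -, -, -, hC⟩ := AbsTopIII.cor_3_6_hypotheses_satisfiable
  obtain ⟨H, hH, hc, T, K, -, -, -, hK⟩ :=
    Δ.exists_not_teleLogPinned_of_telecoreStmt τ hC.telecore hC.incompatible_telecore
  exact hK (h Δ T.J T.telMap K)

/-! ### F-0362: the universal closure of `TelecoreIncompatibleStmt` is false (no Lemma-3.4 obstruction, no incompatibility) -/

/-- **The typed Cor. 3.6 (iv), second sentence, is NOT a consequence of the typing**: there are an
abstract input datum `Δ` (all six categories the one-object discrete category, all functors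
identities, `id_⋎ = 𝟭` fully faithful) and coherent first-row telecore data `τ` at which (ii) HOLDS
(`TelecoreStmt τ`, by `telecoreStmt_of_coherent`) and (iv)'s second incompatibility FAILS: the family
of ALL co-verticial pairs of paths of the telecore diagram, with the unique natural transformations
as homotopies, contains `𝒥`, the contact generators and is `𝔖_log`-pinned.  At this datum the
Lemma-3.4 property fails (`λ^×(a) ≫ ι_log = ι_×` trivially), consistently with
`telecoreIncompatibleStmt_of_lemma34`. [cite: MochizukiAbsTopIII2015, Corollary 3.6 (iv) pp.80–82] -/
theorem exists_telecoreStmt_not_telecoreIncompatibleStmt :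
    ∃ (Δ : LogFrobeniusData.{0}) (τ : Δ.TelecoreData),
      Nonempty Δ.toNexus.FullyFaithful ∧ Δ.TelecoreStmt τ ∧ ¬ Δ.TelecoreIncompatibleStmt τ := by
  let P : Type := Discrete PUnit.{1}
  let Δ : LogFrobeniusData.{0} :=
    { X₁ := P, X := P, toNexus := 𝟭 _, N := P, E := P, A := P,
      log := 𝟭 _, logIsoId := Iso.refl _, lamTimes := 𝟭 _, lamPf := 𝟭 _,
      ιlog := (Functor.punitExt _ _).hom, ιtimes := Sum.inl (Functor.punitExt _ _).hom,
      XtoE := 𝟭 _, NtoE := 𝟭 _,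
      lamTimes_NtoE := Functor.punit_ext' _ _, lamPf_NtoE := Functor.punit_ext' _ _,
      κ := 𝟭 _, AtoE := 𝟭 _, κ_equiv := inferInstance, κ_inv := Functor.punitExt _ _,
      φ := 𝟭 _, φ_equiv := inferInstance, η := Functor.punitExt _ _ }
  let τ : Δ.TelecoreData := { φ₁ := 𝟭 _, e := Functor.punitExt _ _, η₁ := Functor.punitExt _ _ }
  have hT : Δ.TelecoreStmt τ :=
    Δ.telecoreStmt_of_coherent τ (Functor.FullyFaithful.id _) (fun x => Subsingleton.elim _ _)
  refine ⟨Δ, τ, ⟨Functor.FullyFaithful.id _⟩, hT, fun h₄ => ?_⟩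
  obtain ⟨H, hH, hc, T, hTan, -⟩ := hT
  -- in the one-object discrete category any two objects are joined by a unique morphism
  have hP : ∀ x y : Discrete PUnit.{1}, Nonempty (x ⟶ y) ∧ ∀ f g : x ⟶ y, f = g :=
    fun x y => ⟨⟨eqToHom (Subsingleton.elim _ _)⟩, fun _ _ => Subsingleton.elim _ _⟩
  -- and every vertex category of the telecore diagram is that category
  have hhom : ∀ (v : (teleShape T.J).Vertex) (x y : (Δ.teleDiagram T.J T.telMap).obj v),
      Nonempty (x ⟶ y) ∧ ∀ f g : x ⟶ y, f = g := by
    rintro (⟨(_ | _ | _ | _ | _ | _), _⟩ | _) x y <;> exact hP x y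
  -- the family of ALL co-verticial pairs, with the unique natural transformations as homotopies
  let K : (Δ.teleDiagram T.J T.telMap).HomotopyFamily :=
    { E := covert
      isSaturated := isSymmSaturated_covert.toIsSaturated
      η := fun ⦃_ b _ _⦄ _ =>
        { app := fun x => (hhom b _ _).1.some
          naturality := fun _ _ _ => (hhom b _ _).2 _ _ }
      η_refl := fun ⦃_ b _⦄ _ => by
        ext x
        exact (hhom b _ _).2 _ _
      η_trans := fun ⦃_ b _ _ _⦄ _ _ => by
        ext x
        exact (hhom b _ _).2 _ _
      η_whisker := fun ⦃_ _ _ d _ _⦄ _ _ _ => by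
        ext x
        exact (hhom d _ _).2 _ _ }
  refine h₄ H hH hc T hTan ⟨K, fun _ _ _ _ _ => trivial, fun _ _ _ _ _ => trivial, ?_, ?_⟩
  · -- type (2): `([λ^×], [λ^{×pf}])` with `ι_×`
    exact ⟨trivial, fun x e₁ e₂ => (hhom _ _ _).2 _ _⟩
  · -- type (1): `([λ^×]∘[id_⋎]∘[log], [λ^{×pf}]∘[id_{⋎+1}])` with `ι_{log,⋎}`
    exact fun n => ⟨trivial, fun x e₁ e₂ => (hhom _ _ _).2 _ _⟩

/-- **F-0362 is a schema, not a fact: its universal closure is FALSE** (instance forms in the tree: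
`TFModel.telecoreIncompatibleStmt_model`, the (iv)-field of `AbsTopIII.cor_4_5_arch`; conditional
forms `telecoreIncompatibleStmt_of_lemma34` / `AbsTopIII.telecoreIncompatibleStmt_of_lemma44`).
[cite: MochizukiAbsTopIII2015, Corollary 3.6 (iv) pp.80–82] -/
theorem not_forall_telecoreIncompatibleStmt :
    ¬ ∀ (Δ : LogFrobeniusData.{0}) (τ : Δ.TelecoreData), Δ.TelecoreIncompatibleStmt τ := by
  intro h
  obtain ⟨Δ, τ, -, -, hn⟩ := exists_telecoreStmt_not_telecoreIncompatibleStmt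
  exact hn (h Δ τ)

end LogFrobeniusData

/-! ### The named model families at which `TeleLogPinned` fails (Cor. 4.5 (iv) / Cor. 3.6 (iv) at the models) -/

namespace AbsTopIII

variable (𝔄 : AutHolFieldFunctor.{u})

/-- **Cor. 4.5 (iv), second sentence, read positively AT THE ARCHIMEDEAN MODEL** (given an object of `EA`
and the id-rigidity of `EA`, the inputs of `cor_4_5_arch`): over the model data there are a telecore
`𝔗_LH` of the printed shape and a common family `K` of its contact structure `ℋ_LH` and its telecore
family `𝒥` which is NOT `𝔖_log`-pinned — a NAMED family at which the predicate F-0361 fails.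
[cite: MochizukiAbsTopIII2015, Corollary 4.5 (iv) p.109] -/
theorem arch_exists_not_teleLogPinned (X₀ : 𝔄.EA) (hE : IsIdRigid 𝔄.EA) :
    ∃ (H : (archLogFrobeniusData 𝔄).core5Diagram.HomotopyFamily)
      (hH : ∀ ⦃a b : LogFrobeniusData.coreShape5.{u + 1}.Vertex⦄ ⦃p q : Path a b⦄,
        H.E p q → b = LogFrobeniusData.coreShape5.{u + 1}.obs)
      (hc : ((archLogFrobeniusData 𝔄).coreObs5 H hH).IsCore)
      (T : ((archLogFrobeniusData 𝔄).sub 4).Telecore ((archLogFrobeniusData 𝔄).coreObs5 H hH) hc)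
      (K : ((archLogFrobeniusData 𝔄).teleDiagram T.J T.telMap).HomotopyFamily),
      (archLogFrobeniusData 𝔄).IsTelecoreAn (archTelecoreData 𝔄) T ∧
      (∀ ⦃a b : (LogFrobeniusData.teleShape T.J).Vertex⦄ (p q : Path a b), T.Jfam.E p q → K.E p q) ∧
      (∀ ⦃a b : (LogFrobeniusData.teleShape T.J).Vertex⦄ (p q : Path a b),
        LogFrobeniusData.ContactGen p q → K.E p q) ∧
      ¬ (archLogFrobeniusData 𝔄).TeleLogPinned K := by
  have h : (archLogFrobeniusData 𝔄).LogFrobeniusCompatible (archTelecoreData 𝔄) := cor_4_5_arch 𝔄 X₀ hE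
  exact (archLogFrobeniusData 𝔄).exists_not_teleLogPinned_of_telecoreStmt (archTelecoreData 𝔄)
    h.telecore h.incompatible_telecore

namespace TFModel

variable {p : ℕ} [Fact p.Prime] {P : ObjectProperty (TFModel p)} {D : Type 1} [Category.{1} D]

/-- **Cor. 3.6 (iv), second sentence, read positively AT THE MLF-GALOIS MODEL** (given a Cor-1.10 datum
`I` and an object `x₀`, the inputs of `telecoreIncompatibleStmt_model`): over the model data there are a
telecore `𝔗_An` of the printed shape and a common family `K` of `ℋ_An` and `𝒥` which is NOT
`𝔖_log`-pinned — a NAMED family at which the predicate F-0361 fails.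
[cite: MochizukiAbsTopIII2015, Corollary 3.6 (iv) pp.80–82] -/
theorem exists_not_teleLogPinned_model (I : AnabelianInput p P D) (x₀ : P.FullSubcategory) :
    ∃ (H : (monoAnabelianData I).toLogFrobeniusData.core5Diagram.HomotopyFamily)
      (hH : ∀ ⦃a b : LogFrobeniusData.coreShape5.{1}.Vertex⦄ ⦃p q : Path a b⦄,
        H.E p q → b = LogFrobeniusData.coreShape5.{1}.obs)
      (hc : ((monoAnabelianData I).toLogFrobeniusData.coreObs5 H hH).IsCore)
      (T : ((monoAnabelianData I).toLogFrobeniusData.sub 4).Telecore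
        ((monoAnabelianData I).toLogFrobeniusData.coreObs5 H hH) hc)
      (K : ((monoAnabelianData I).toLogFrobeniusData.teleDiagram T.J T.telMap).HomotopyFamily),
      (monoAnabelianData I).toLogFrobeniusData.IsTelecoreAn (monoAnabelianData I).telecoreData T ∧
      (∀ ⦃a b : (LogFrobeniusData.teleShape T.J).Vertex⦄ (p q : Path a b), T.Jfam.E p q → K.E p q) ∧
      (∀ ⦃a b : (LogFrobeniusData.teleShape T.J).Vertex⦄ (p q : Path a b),
        LogFrobeniusData.ContactGen p q → K.E p q) ∧
      ¬ (monoAnabelianData I).toLogFrobeniusData.TeleLogPinned K :=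
  (monoAnabelianData I).toLogFrobeniusData.exists_not_teleLogPinned_of_telecoreStmt
    (monoAnabelianData I).telecoreData (telecoreStmt_model I) (telecoreIncompatibleStmt_model I x₀)

end TFModel

end AbsTopIII

end Literature.AnabelianGeometry.AbsoluteAnabelian
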